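import Literature.AlgebraicGeometry.HodgeTheory.AlgebraicClassesHodgeType
import Literature.AlgebraicGeometry.HodgeTheory.FundamentalClassNonvanishing
import Mathlib.Topology.JacobsonSpace
import HarnessLib

/-!
# Algebraic classes are Hodge classes, unconditionally (Voisin I, Prop. 11.20 on the summit carriers)

Family `hodge`, layer `Literature/AlgebraicGeometry/HodgeTheory`. Theorems-only companion (no
definitions, no named facts; D-0026) of `AlgebraicClassesHodgeType`, which proves C. Voisin, *Hodge
Theory and Complex Algebraic Geometry I* (2002), Prop. 11.20 — every class of
`algebraicClasses Y k = Nᵏ H²ᵏ(Y(ℂ); ℂ)` is of Hodge type `(k, k)` — granted the named fact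
`map_fundamentalClass_ne_zero_of_height_eq` (non-vanishing of `τ(ℂ)_* [V(ℂ)]` for every GENERICALLY
FINITE `τ`). The printed proof only ever applies that non-vanishing to a RESOLUTION `τ : V ⟶ Y` of an
irreducible closed `Z`, which is an isomorphism onto its image over a dense open; at a complex point
over that locus `τ` is surjective on stalks, and there the non-vanishing is the theorem
`map_fundamentalClass_ne_zero_of_stalkMap_surjective` (`FundamentalClassNonvanishing`, Wirtinger). Hence:

* `exists_resolution_stalkMap_surjective` — projective Hironaka (`Resolution.Hironaka1964_projective_holds`)
  with a stalk-surjective complex point (a closed point of the preimage of the isomorphism locus; `V`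
  is a Jacobson space);
* `complexGysin_one_ne_zero_of_stalkMap_surjective` — `τ_* 1_V ≠ 0` for such `τ`
  (`capProduct_complexGysin_one`);
* `isOfHodgeType_of_restrictCompl_eq_zero_of_isIrreducible_of_isSmoothProjective`,
  `isOfHodgeType_of_mem_algebraicClasses_of_isSmoothProjective` — **Prop. 11.20 on the summit
  carriers, unconditionally**: for `Y` smooth projective of dimension `n` and `x ∈ algebraicClasses Y k`,
  `IsOfHodgeType n Y (2k) k k x` (the proofs of `AlgebraicClassesHodgeType` verbatim, with the fact
  replaced by the theorem).

This discharges the hypothesis `hA` of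
`Summits/HodgeConjecture/HodgeConjecture/Theorems/EndoscopicMiddleDegreeOrthogonalSplitOfFacts.orthogonalSplit_of_algebraicClasses_isOfHodgeType`
(route item `OrthogonalSplit`), and the pure case `s = k`, degree `2k`, of
`Grothendieck1969_supportedClasses_le_hodgeConiveau`. The general fact
`map_fundamentalClass_ne_zero_of_height_eq` (generically finite `τ` of degree `> 1`) is NOT discharged
here: it needs "unramified ⇒ immersive" at a generically étale point instead of stalk-surjectivity.

## References

* [VoisinHodgeI2002] C. Voisin, Hodge Theory and Complex Algebraic Geometry I (CUP 2002), §7.3.2,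
  §11.1.2–11.1.4, Prop. 11.20.
* [Fulton1998] W. Fulton, Intersection Theory (1998), §19.1 Lemma 19.1.1, Lemma 19.1.2.
* [Kollar2007] J. Kollár, Lectures on Resolution of Singularities (2007), Thm. 3.27.
* [GriffithsHarrisPrinciples1978] P. Griffiths, J. Harris, Principles of Algebraic Geometry (1978),
  Ch. 0 §7.
* [Hartshorne1977] R. Hartshorne, Algebraic Geometry (1977), II Ex. 3.11.
-/

noncomputable section

open scoped Manifold
open CategoryTheory AlgebraicGeometry
open Literature.AlgebraicTopology.SingularHomology
open Literature.AlgebraicGeometry.Motives (ComplexPoints AlgPoints)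

namespace Literature.AlgebraicGeometry.HodgeTheory

section HodgeTheory

variable {n : ℕ} {Y : Motives.SchemeOver ℂ}

/-! ### A resolution of the closure of a point, with a point where it is a closed immersion to first order -/

/-- **Resolving the closure of a point, with a good point.** For a point `z` of a smooth projective `Y`
with `dim closure {z} = d` there are a morphism `τ : V ⟶ Y` from a smooth projective `V` of dimension
`d` mapping the generic point of `V` to `z` (projective Hironaka, `Resolution.Hironaka1964_projective_holds`,
composed with the closed immersion of `closure {z}`) AND a complex point `P` of `V` at which
`𝒪_{Y, τP} → 𝒪_{V, P}` is surjective: a closed point of the preimage of the isomorphism locus `U` of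
the resolution `π` (non-empty open in the Jacobson space `V`), where `τ = π ≫ ι` is surjective on
stalks (`stalkMap_comp_surjective_of_isIso_morphismRestrict`). [cite: Kollar2007, Thm. 3.27]
[cite: Hartshorne1977, II Ex. 3.11] -/
theorem exists_resolution_stalkMap_surjective (hY : Motives.IsSmoothProjective n Y) (z : Y.left)
    {d : ℕ} (hzd : Order.height z = d) :
    ∃ (V : Motives.SchemeOver ℂ) (τ : V ⟶ Y) (η : V.left) (P : ComplexPoints V),
      Motives.IsSmoothProjective d V ∧ IsGenericPoint η Set.univ ∧ τ.left.base η = z ∧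
      Function.Surjective (τ.left.stalkMap P.pt) := by
  set X₀ := Motives.ClosedSubvariety.ofPoint Y.left z with hX₀
  obtain ⟨d', V, π, hV, hπ, hdim⟩ :=
    exists_resolution_ofPoint Resolution.Hironaka1964_projective_holds hY z
  obtain rfl : d' = d := by
    rw [hzd] at hdim
    exact_mod_cast hdim.symm
  haveI : IsIntegral X₀.toSchemeOver.left := inferInstanceAs (IsIntegral X₀.carrier)
  haveI : IsIntegral V.left := Motives.IsSmoothProjective.isIntegral_holds hV
  haveI : LocallyOfFiniteType V.hom := locallyOfFiniteType_of_isSmoothProjective hV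
  haveI : JacobsonSpace V.left := LocallyOfFiniteType.jacobsonSpace V.hom
  -- the isomorphism locus `U` of `π` and a closed point of `π⁻¹ U`
  have hπ' := hπ
  obtain ⟨U, -, hU'd, hiso⟩ := hπ'
  haveI := hiso
  have hne : ((π.left ⁻¹ᵁ U : V.left.Opens) : Set V.left).Nonempty := hU'd.nonempty
  obtain ⟨p, hpU, hpcl⟩ := nonempty_inter_closedPoints hne (π.left ⁻¹ᵁ U).isOpen.isLocallyClosed
  set P : ComplexPoints V := (Motives.ComplexPoints.equivClosedPoints (X := V)).symm ⟨p, hpcl⟩ with hP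
  have hPpt : P.pt = p := by
    have h := Motives.ComplexPoints.coe_equivClosedPoints_apply V P
    rw [hP, Equiv.apply_symm_apply] at h
    exact h.symm
  refine ⟨V, π ≫ X₀.ιOver, genericPoint V.left, P, hV, genericPoint_spec V.left, ?_, ?_⟩
  · rw [Over.comp_left, Scheme.Hom.comp_base, TopCat.comp_app, base_genericPoint_of_isBirational hπ]
    exact Motives.ClosedSubvariety.genericPoint_ofPoint z
  · rw [Over.comp_left, hPpt]
    exact @stalkMap_comp_surjective_of_isIso_morphismRestrict _ _ _ π.left X₀.ι
      X₀.isClosedImmersion U hiso p hpU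

/-! ### `τ_* 1 ≠ 0` for such a resolution -/

/-- **`τ_* 1_V ≠ 0`** in `H^{2e}(Y(ℂ); ℂ)` (`d + e = n`) as soon as `τ : V ⟶ Y` (smooth projective,
`dim V = d`) is surjective on the stalk at one complex point: `τ_* 1 ⌢ [Y(ℂ)] = τ(ℂ)_* [V(ℂ)]`
(`capProduct_complexGysin_one`) and the latter is non-zero
(`map_fundamentalClass_ne_zero_of_stalkMap_surjective`, Wirtinger).
[cite: GriffithsHarrisPrinciples1978, Ch. 0 §7 pp. 109–111] [cite: FultonYoungTableaux1997, Appendix B §B.1 (5)] -/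
theorem complexGysin_one_ne_zero_of_stalkMap_surjective (μ : OrientationFamily)
    (hY : Motives.IsSmoothProjective n Y) {d : ℕ} {V : Motives.SchemeOver ℂ}
    (hV : Motives.IsSmoothProjective d V) (τ : V ⟶ Y) (P : ComplexPoints V)
    (hτ : Function.Surjective (τ.left.stalkMap P.pt)) {e : ℕ} (hde : d + e = n) :
    complexGysin μ hV hY τ (show 0 + 2 * n = 2 * e + 2 * d by omega)
      (singularCohomology.one ℂ (Motives.ComplexPoints V)) ≠ 0 := by
  intro h0
  have h1 := capProduct_complexGysin_one (OrientationFamily.hasPoincareDuality μ) hV hY τ hde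
  rw [h0, LinearMap.map_zero, LinearMap.zero_apply] at h1
  exact map_fundamentalClass_ne_zero_of_stalkMap_surjective μ hY hV τ P hτ h1.symm

/-! ### Prop. 11.20, unconditionally -/

/-- **The classes of `H²ᵏ(Y(ℂ); ℂ)` dying off an irreducible closed `Z` of codimension `k` are of Hodge
type `(k, k)`** — the theorem `isOfHodgeType_of_restrictCompl_eq_zero_of_isIrreducible` with its
hypothesis (the named fact `map_fundamentalClass_ne_zero_of_height_eq`) replaced by the PROVED
non-vanishing at a stalk-surjective point of a resolution (`exists_resolution_stalkMap_surjective`,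
`complexGysin_one_ne_zero_of_stalkMap_surjective`); same proof otherwise (purity: the kernel is the
line `ℂ · τ_* 1`, of type `(k,k)`). [cite: VoisinHodgeI2002, §11.1.2 Prop. 11.20, §11.1.4 and §7.3.2]
[cite: Fulton1998, §19.1 Lemma 19.1.1 and Lemma 19.1.2] -/
theorem isOfHodgeType_of_restrictCompl_eq_zero_of_isIrreducible_of_isSmoothProjective
    (hY : Motives.IsSmoothProjective n Y)
    {Z : Set Y.left} (hZ : IsClosed Z) (hZi : IsIrreducible Z) {k : ℕ}
    (hk : Order.coheight hZi.genericPoint = k) (hcZ : ∀ z ∈ Z, (k : ℕ∞) ≤ Order.coheight z)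
    {x : complexBetti Y (2 * k)} (hx : complexBetti.restrictCompl Y Z (2 * k) x = 0) :
    IsOfHodgeType n Y (2 * k) k k x := by
  obtain ⟨A⟩ := (nonempty_hodgeModel_holds (n := n) (X := Y)).nonempty hY
  rcases Nat.eq_zero_or_pos k with rfl | hk1
  · exact isOfHodgeType_zero_zero_zero A x
  -- dimension and codimension of `Z = closure {z}`
  set z := hZi.genericPoint with hzdef
  have hzZ : z ∈ Z := (hZi.isGenericPoint_genericPoint hZ).mem
  obtain ⟨d, c, hzd, hzc, hdc⟩ := exists_height_eq_coheight_eq hY z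
  obtain rfl : c = k := by
    rw [hzc] at hk
    exact_mod_cast hk
  -- a resolution `τ : V ⟶ Y` of `Z` with a stalk-surjective point `P`
  obtain ⟨V, τ, η, P, hV, hη, hτη, hτP⟩ := exists_resolution_stalkMap_surjective hY z hzd
  -- the orientation family of the complex orientations and its Gysin image of `1`
  let μ : OrientationFamily := fun _ _ hW ↦ (Motives.ComplexPoints.isOrientableOver ℂ hW).some
  have hμ : μ.HasPoincareDuality := OrientationFamily.hasPoincareDuality μ
  set y₀ : complexBetti Y (2 * c) := complexGysin μ hV hY τ (show 0 + 2 * n = 2 * c + 2 * d by omega)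
    (singularCohomology.one ℂ (Motives.ComplexPoints V)) with hy₀def
  -- `y₀ ≠ 0` (Wirtinger)
  have hy0 : y₀ ≠ 0 := complexGysin_one_ne_zero_of_stalkMap_surjective μ hY hV τ P hτP hdc
  -- `y₀` dies off `Z`: `τ(V) ⊆ Z`
  have hpre : τ.left.base ⁻¹' Z = Set.univ := by
    refine Set.eq_univ_of_forall fun v ↦ ?_
    have hgen' := hη.image τ.left.continuous
    rw [Set.image_univ, hτη] at hgen'
    have h1 : τ.left.base v ∈ closure (Set.range τ.left.base) := subset_closure ⟨v, rfl⟩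
    rw [← hgen'.def] at h1
    exact closure_minimal (Set.singleton_subset_iff.2 hzZ) hZ h1
  have hy₀ker : complexBetti.restrictCompl Y Z (2 * c) y₀ = 0 := by
    refine complexGysin_restrictCompl_eq_zero (gysinMap_restrictCompl_eq_zero_of_field ℂ) μ hμ hV hY τ
      _ hZ _ ?_
    haveI : IsEmpty (Motives.complexPointsCompl V (τ.left.base ⁻¹' Z)) :=
      ⟨fun P ↦ P.2 (Set.eq_univ_iff_forall.1 hpre _)⟩
    haveI := ModuleCat.subsingleton_of_isZero
      (Motives.isZero_singularCohomology_of_isEmpty ℂ ℂ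
        (E := Motives.complexPointsCompl V (τ.left.base ⁻¹' Z)) 0)
    exact Subsingleton.elim _ _
  -- `y₀` is of type `(c, c)`
  have hy₀T : IsOfHodgeType n Y (2 * c) c c y₀ := by
    obtain ⟨B⟩ := (nonempty_hodgeModel_holds (n := d) (X := V)).nonempty hV
    exact isOfHodgeType_complexGysin hodgePQ_independent_of_hodgeModel_holds
      (fun _ _ ↦ nonempty_hodgeModel_holds)
      (fun E _ _ _ ↦ Literature.NumberTheory.Transcendental.exists_deRhamIsoFamily_holds E) μ hV hY τ _
      (p := 0) (q := 0) (by omega) (by omega) (isOfHodgeType_zero_zero_zero B _)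
  -- purity: the kernel is at most a line, hence `= ℂ · y₀`
  obtain ⟨t, ht⟩ := exists_ker_restrictCompl_le_span_of_isIrreducible hY hZ hZi hk1 hcZ
  obtain ⟨a, ha⟩ := Submodule.mem_span_singleton.1 (ht (LinearMap.mem_ker.2 hy₀ker))
  obtain ⟨b, hb⟩ := Submodule.mem_span_singleton.1 (ht (LinearMap.mem_ker.2 hx))
  have ha0 : a ≠ 0 := by
    rintro rfl
    rw [zero_smul] at ha
    exact hy0 ha.symm
  have hxy : x = (b / a) • y₀ := by
    rw [← hb, ← ha, smul_smul, div_mul_cancel₀ b ha0]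
  rw [hxy]
  exact IsOfHodgeType.smul hy₀T _

/-- **Algebraic classes are Hodge classes (Voisin I, Prop. 11.20), unconditionally on the summit
carriers**: for `Y` smooth projective of dimension `n`, every class of
`algebraicClasses Y k = Nᵏ H²ᵏ(Y(ℂ); ℂ)` is of Hodge type `(k, k)` — the theorem
`isOfHodgeType_of_mem_algebraicClasses` with the named fact `map_fundamentalClass_ne_zero_of_height_eq`
no longer needed (the resolutions of `exists_resolution_stalkMap_surjective` come with a point where they
are closed immersions to first order, where Wirtinger's argument applies:
`map_fundamentalClass_ne_zero_of_stalkMap_surjective`). This is the pure case `s = k`, degree `2k`, of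
Grothendieck's coniveau inclusion `Grothendieck1969_supportedClasses_le_hodgeConiveau`, now a theorem.
[cite: VoisinHodgeI2002, §11.1.2 Prop. 11.20] [cite: GrothendieckTopology1969, p. 299 (∗)] -/
theorem isOfHodgeType_of_mem_algebraicClasses_of_isSmoothProjective
    (hY : Motives.IsSmoothProjective n Y) (k : ℕ) {x : complexBetti Y (2 * k)}
    (hx : x ∈ algebraicClasses Y k) : IsOfHodgeType n Y (2 * k) k k x := by
  obtain ⟨A⟩ := (nonempty_hodgeModel_holds (n := n) (X := Y)).nonempty hY
  have hI := hodgePQ_independent_of_hodgeModel_holds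
  rw [algebraicClasses_eq_iSup_coheight_genericPoint_eq hY k] at hx
  rw [hI.isOfHodgeType_iff hY A]
  let S : Submodule ℂ (complexBetti Y (2 * k)) := (A.hodgePQ (2 * k) k k).comap (A.pullback (2 * k)).hom
  change x ∈ S
  suffices hle : (⨆ (Z : Set Y.left) (_ : IsClosed Z) (hZi : IsIrreducible Z)
      (_ : ∀ v ∈ Z, (k : ℕ∞) ≤ Order.coheight v) (_ : Order.coheight hZi.genericPoint = k),
      LinearMap.ker (complexBetti.restrictCompl Y Z (2 * k)).hom) ≤ S from hle hx
  refine iSup_le fun Z ↦ iSup_le fun hZ ↦ iSup_le fun hZi ↦ iSup_le fun hcZ ↦ iSup_le fun hk ↦ ?_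
  intro y hy
  change A.pullback (2 * k) y ∈ A.hodgePQ (2 * k) k k
  rw [← hI.isOfHodgeType_iff hY A]
  exact isOfHodgeType_of_restrictCompl_eq_zero_of_isIrreducible_of_isSmoothProjective hY hZ hZi hk hcZ
    (LinearMap.mem_ker.1 hy)

end HodgeTheory

end Literature.AlgebraicGeometry.HodgeTheory

end
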